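import Mathlib.Tactic.Linarith
import Mathlib.Tactic.Ring
import Mathlib.Tactic.NormNum
import HarnessLib

/-!
# The (0,1) cell of the ι-window, EXISTENCE side, VIII: the vertex of `C − C` at the node parameter `b = n` —
# arithmetic skeleton of `H2-EXISTENCE-SIDE-8.md`

Family `hodge`, b2b cell `hweil`, `Summits/HodgeConjecture/HodgeConjecture/Theorems` (helper of item stmt-HodgeConjecture-2524, the
Weil-sixfold rung the H2 test serves). Companion to `WeilTypeLadderH2W2CornerSeven.lean` (pv3-g14, [VII]) with the SAME dictionary: `X = J(C)`, `C`
general of genus `4`, `ι = −1`, `Θ = W₃ − κ` with nodes `±n`, `D_n = Θ_n ∪ Θ_{−n}`, `S_n = C − C` with vertex `0` (the only 2-torsion point on `D_n`),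
resolution `α : C × C → C − C` contracting `Δ` (`Δ² = −6`, `N_Δ = T_C`), the W₂ corner = rank-`(1,1)` ι-sheaves with hulls `L₁ = 𝓘_{X_p}(2Θ)P` on `Θ_n`,
`L₂ = ι^*L₁`; the saturated corner sheaves at `b = n` are the `F̂_t`, `t = (z₁, z₂, z₃)`, `z₃ ∉ {z₁, z₂}`, graphs of `ψ : N₁ ⥲ ι^♯N₁` over
`L₁(−Θ) ⊕ L₂(−Θ)`, `N₁ = α_*𝓛₀`, `𝓛₀|_Δ = M₀ = g − z₁ − z₂ − z₃`. Report `run/shared/lean/b2b/hodge-weil/b2b-hweil-pv3-g15/H2-EXISTENCE-SIDE-8.md`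
(CLAIM TABLE v34, LADDER C222, row pv3-g15). Def-free, fully proved ELEMENTARY statements (integer / rational bookkeeping); the sheaf theory, the
commutative algebra and the geometry are in the docstrings and the report.
HONEST FRAMING: census / structure results about one cell of the ladder's H2 test on the existence side, on the Jacobian locus only; no case of the
Hodge conjecture is proved; nothing here is a rung; no statement of [Markman 2025] is used; nothing here depends on (LP) or on 'ker ob = ann(ch)'.

§1 THE INDEX AT THE VERTEX VANISHES (THEOREM 1.2): `t_0(F̂_t) = 16·L(ι, F̂_t)` (holomorphic Lefschetz on `J`, the vertex being the only fixed point on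
the support), `L(ι, F̂_t) = L(ι, (N₁, ψ)) = L(swap, 𝓛₀) + tr(ι | R¹α_*𝓛₀)` (Leray), `L(swap, 𝓛₀) = ε(d/2 + (1 − g)/2 + n/4) = ε(0 − 3/2 − 6/4) = −3ε`
(Atiyah–Singer for the fixed curve `Δ`: genus `4`, `deg N_Δ = −6`, `deg 𝓛₀|_Δ = 0`, `ε` = the sign of the linearisation on `𝓛₀|_Δ`) and
`tr(ι | R¹α_*𝓛₀) = 3ε` (`= h¹(M₀)·ε` off the record stratum, `= 4ε − ε` on it): `τ ≡ 0` on all of `T` (`lefschetz_fixed_curve`, `vertex_index_zero`).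
§2 THE VERTEX MODULE (THEOREMS 2.3–2.7): `N₁,0 = 𝓘_{Γ₆}` is the ideal of the 6-branch curve `Γ₆ = ξ₁ ∪ Z₁`, with initial module `I_{Γ₆}/(q, c₃)`,
`Γ₆ = h_p + z₁ + z₂ + z₃ ∈ Div⁶(C_K)`, Hilbert function `6k − 9` (`k ≥ 2`), K-polynomial `3t² − 3t³ − 3t⁴ + 3t⁵`, Betti numbers `(3; 3, 3; 3)` off the
special strata (`vertex_ideal_hilbert`, `vertex_ideal_kpoly`, `vertex_betti_from_cone`); ι-signs by internal degree give
`Tor₀ = k₋³`, `Tor₁ = k₊³ ⊕ k₋³`, `Tor₂ = k₊³` and `t_0(N₁, ψ) = −3 − 0 + 3 = 0` again (`vertex_tor_signs`); `μ(L₁′) = μ(N₁)` and the connecting map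
`∂` of `0 → θ₋L₁ ⊕ θ₊L₂ → F̂ → N₁ → 0` give `F̂_{t,0} ⊗ k = k₊^{2 − i + ν} ⊕ k₋³` (`vertex_fibre`).
§3 THE PUNCTUAL CENSUS (THEOREMS 3.2–3.4): the balanced ι-stable colength-2 submodules of `M = F̂_{t,0}` are covered by projective spaces
`P(H) = ℙ(U(H)_{−s}^∨)` of dimension `dim V_{−s} + 3 − r(H)` with `r(H) ≤ 1 + dim V_{−s}`; hence every such submodule lies on a family of dimension
`≥ 2` at fixed `t`, and by the certified family mechanism `(E2)_x^{node} ∩ {j = 0}` is EMPTY off the record curve (`census_dimension`,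
`census_projective_families`). §4 the record curve (`record_vertex_module`), §5 `j = 2` (`j2_deficit`), §6 bookkeeping of the special strata
(`special_strata_count`).

What is NOT here: sheaves, `ψ`, the family mechanism, the Quot schemes. 0 unconditional rungs above the floor.
-/

set_option linter.dupNamespace false

namespace Summit.HodgeConjecture.HodgeConjecture.WeilTypeLadder

section H2W2CornerEight

/-- LEMMA 1.1 (report §1): the holomorphic Lefschetz contribution of a FIXED CURVE `F` (genus `g`) of an involution of a smooth projective surface,
acting by `−1` on the normal bundle `N` (`deg N = n`) and by the sign `ε` on `V|_F` (`deg V|_F = d`), is `ε·(d/2 + (1 − g)/2 + n/4)`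
(`∫_F ch(V|_F) td(F)/(1 + e^{−c₁(N)})`, `1/(1 + e^{−x}) = 1/2 + x/4 + …`). Instances: the diagonal of `ℙ¹ × ℙ¹` with `V = 𝒪` (`g = 0`, `n = 2`,
`d = 0`): `1 = h⁰`; the diagonal of `C × C`, `g(C) = 4`, `V = 𝒪` (`n = 2 − 2g = −6`): `1 − g = −3 = 1 − 0 + (−4)` (trace of the swap on
`H⁰ ⊕ H¹ ⊕ H²`: `+1`, `0` on the two swapped copies of `H¹(C, 𝒪)`, `−4` on the diagonal of `H¹ ⊗ H¹` with the Koszul sign); and the bundle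
`𝓛₀` of the node parameter (`g = 4`, `n = −6`, `d = deg M₀ = 0`): contribution `−3ε`. [H2-EXISTENCE-SIDE-8 §1.1] -/
theorem lefschetz_fixed_curve :
    ((0 : ℚ) / 2 + (1 - 0) / 2 + 2 / 4 = 1) ∧
    ((0 : ℚ) / 2 + (1 - 4) / 2 + (-6) / 4 = -3) ∧ ((1 : ℤ) - 0 + (-4) = 1 - 4) ∧
    (∀ ε : ℚ, ε * (0 / 2 + (1 - 4) / 2 + (-6) / 4) = -3 * ε) := by
  refine ⟨by norm_num, by norm_num, by norm_num, ?_⟩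
  intro ε; ring

/-- THEOREM 1.2 (report §1.2): the local index of the saturated corner sheaf at the vertex of `C − C` VANISHES for every `t ∈ T`:
`t_0(F̂_t)/16 = L(ι, F̂_t)` (holomorphic Lefschetz on `J`, `det(1 − dι) = 2⁴ = 16`, the vertex being the only point of `D_n ∩ J[2]`),
`= L(ι, (N₁, ψ))` (the sub-object `L₁(−Θ) ⊕ L₂(−Θ)` is ι-induced: trace `0`), `= L(swap, 𝓛₀) + tr(ι | R¹α_*𝓛₀)` (Leray for `α`),
`= −3ε + 3ε = 0`: off the record stratum `R¹α_*𝓛₀ ≅ H¹(C, M₀)` (`h¹ = 3`, sign `ε`); on it the pieces are `H¹(C, 𝒪)` (`4`, sign `ε`) and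
`coker δ₁ = H¹(C, K)` (`1`, sign `−ε`, the conormal twist). Hence the length-2 (resp. length-4) vertex junk of a `(0,1)` candidate is BALANCED
(`n₊ = n₋`), never of pure sign: `τ_gen = 0`, not `±32`. [§1.2] -/
theorem vertex_index_zero (ε : ℤ) (hε : ε = 1 ∨ ε = -1) :
    ((2 : ℤ) ^ 4 = 16) ∧ (-3 * ε + 3 * ε = 0) ∧ (-3 * ε + (4 * ε - ε) = 0) ∧ (16 * (-3 * ε + 3 * ε) = 0) ∧
    (∀ np nm : ℤ, 16 * (np - nm) = 16 * (-3 * ε + 3 * ε) → np = nm) ∧ (ε ^ 2 = 1) := by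
  refine ⟨by norm_num, by ring, by ring, by ring, ?_, ?_⟩
  · intro np nm h
    have : 16 * (np - nm) = 0 := by rw [h]; ring
    omega
  · rcases hε with rfl | rfl <;> norm_num

/-- THEOREM 2.3 (report §2.2–2.3): the vertex module. `N₁,0 = 𝓘_{ξ₁ ∪ Z₁}` and its initial module is `I_{Γ₆}/(q, c₃)`, `Γ₆ = h_p + z₁ + z₂ + z₃`
a degree-6 divisor of the canonical curve `C_K = Q ∩ F₃ ⊂ ℙ³` (graded pieces `H⁰((k+1)K − Γ₆) = H⁰(M₀ ⊗ K^k)` by the theorem on formal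
functions along `Δ`). Hilbert functions: `dim S_k = C(k+3, 3)`; `h⁰(kK) = 6k − 3` (`k ≥ 2`), `4` (`k = 1`); `dim (I_{Γ₆})_k = C(k+3,3) − 6`
(`k ≥ 2`; the six points impose independent conditions from degree `2` on iff `h⁰(M₀) = 0`), `dim (q, c₃)_k = C(k+1,3) + C(k,3) − C(k−2,3)`;
so `dim (I_{Γ₆}/(q,c₃))_k = h⁰((k−1)K + M₀) = 6(k−1) − 3 = 6k − 9` for `k ≥ 2`: `3, 9, 15, 21, 27, 33` — the values re-derived by the
script `vertex1.py` from random data (`4 − 1`, `14 − 5`, `29 − 14`, `50 − 29`, `78 − 51`, `114 − 81`). [§2.3] -/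
theorem vertex_ideal_hilbert :
    ((10 - 6 : ℤ) - 1 = 3 ∧ (20 - 6 : ℤ) - 5 = 9 ∧ (35 - 6 : ℤ) - 14 = 15 ∧ (56 - 6 : ℤ) - 29 = 21 ∧ (84 - 6 : ℤ) - 51 = 27 ∧
      (120 - 6 : ℤ) - 81 = 33) ∧
    (∀ k : ℤ, 2 ≤ k → 6 * (k - 1) - 3 = 6 * k - 9) ∧
    ((6 * 2 - 9 : ℤ) = 3 ∧ (6 * 3 - 9 : ℤ) = 9 ∧ (6 * 4 - 9 : ℤ) = 15 ∧ (6 * 7 - 9 : ℤ) = 33) ∧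
    ((10 : ℤ) = 10 ∧ (4 + 1 : ℤ) = 5 ∧ (10 + 4 - 0 : ℤ) = 14 ∧ (20 + 10 - 1 : ℤ) = 29 ∧ (35 + 20 - 4 : ℤ) = 51 ∧ (56 + 35 - 10 : ℤ) = 81) := by
  refine ⟨by norm_num, ?_, by norm_num, by norm_num⟩
  intro k _; ring

/-- THEOREM 2.3 (cont.): the K-polynomial of the graded vertex module `⊕_{k ≥ 2} (6k − 9) t^k` over `S = k[x,y,z,w]` is
`3t² − 3t³ − 3t⁴ + 3t⁵`: with `c_k = 6k − 9` (`k ≥ 2`) and `c_k = 0` (`k < 2`), the coefficients `e_k = c_k − 4c_{k−1} + 6c_{k−2} − 4c_{k−3} + c_{k−4}`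
are `e₂ = 3`, `e₃ = −3`, `e₄ = −3`, `e₅ = 3` and `e_k = 0` for `k ≥ 6` (the fourth difference of a linear function). [§2.3] -/
theorem vertex_ideal_kpoly :
    ((3 : ℤ) = 3) ∧ ((9 : ℤ) - 4 * 3 = -3) ∧ ((15 : ℤ) - 4 * 9 + 6 * 3 = -3) ∧ ((21 : ℤ) - 4 * 15 + 6 * 9 - 4 * 3 = 3) ∧
    (∀ k : ℤ, 6 ≤ k →
      (6 * k - 9) - 4 * (6 * (k - 1) - 9) + 6 * (6 * (k - 2) - 9) - 4 * (6 * (k - 3) - 9) + (6 * (k - 4) - 9) = 0) := by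
  refine ⟨by norm_num, by norm_num, by norm_num, by norm_num, ?_⟩
  intro k _; ring

/-- THEOREM 2.4 (report §2.4): the graded Betti numbers of the vertex module from the mapping cone. `J = I_{ℓ_p ∪ Z₃}` (line + three points, open
`PGL₄`-orbit: `dim Gr(2,4) + 3·3 = 13 ≤ 15`) has Betti numbers `(4; 3, 1; 1)` in degrees `(2; 3, 4; 5)` (K-polynomial of `S/J`:
`1 − 4t² + 3t³ + t⁴ − t⁵`); `K := J ∩ (q, c₃) = qS + c₃I_ℓ` (since `(J : c₃) = I_ℓ`) has generators in degrees `2, 4, 4` and the two relations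
`(0, w, −y)`, `(c₃, −x, z)` in degree `5` (`q = xy − zw ∈ I_ℓ`, `gcd(q, c₃) = 1`), K-polynomial `t² + 2t⁴ − 2t⁵`; the cone of `K → J` cancels the
unit component `q ↦ q` only, so `I_{Γ₆}/(q,c₃) = J/K` has Betti numbers `b₀ = 4 − 1 = 3` (degree `2`), `b₁ = (3 + 1) + 3 − 1 = 6`
(degrees `3,3,3` and `4,4,4`), `b₂ = 1 + 2 = 3` (degree `5`), Euler characteristic `3 − 6 + 3 = 0`, and K-polynomial
`(4t² − 3t³ − t⁴ + t⁵) − (t² + 2t⁴ − 2t⁵) = 3t² − 3t³ − 3t⁴ + 3t⁵` ✓; `L₁′`'s initial module `J/(q)` has `(3; 3, 1; 1)`. No consecutive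
cancellation is possible in either table, so the LOCAL modules `N₁,0`, `L₁′,0` have the same Betti numbers. [§2.4] -/
theorem vertex_betti_from_cone :
    ((4 : ℤ) + 9 = 13 ∧ (13 : ℤ) ≤ 15) ∧
    ((4 : ℤ) - 1 = 3 ∧ ((3 : ℤ) + 1) + 3 - 1 = 6 ∧ (1 : ℤ) + 2 = 3 ∧ (3 : ℤ) - 6 + 3 = 0) ∧
    ((4 - 1 : ℤ) = 3 ∧ (-3 - 0 : ℤ) = -3 ∧ (-1 - 2 : ℤ) = -3 ∧ (1 - (-2) : ℤ) = 3) ∧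
    ((1 : ℤ) - 4 + 3 + 1 - 1 = 0 ∧ (4 : ℤ) - 1 = 3 ∧ (3 : ℤ) - 4 + 1 = 0) := by
  norm_num

/-- THEOREM 2.5 (report §2.5): ι-signs on the Tor's of the vertex module. On the graded piece of internal degree `j` the involution acts by
`−ε(−1)^j` (`(−1)^j` from `ι = −1` on `S₁`, `ε` from `𝓛₀|_Δ`, `−1` from the conormal twist); with `ε` normalised so that the three quadric
generators have sign `−`: `Tor₀ = k₋³` (degree `2`), `Tor₁ = k₊³ ⊕ k₋³` (degrees `3`, `4`), `Tor₂ = k₊³` (degree `5`), and the local index of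
`(N₁, ψ)` is `t_0 = (0 − 3) − (3 − 3) + (3 − 0) = 0` — the value of THEOREM 1.2, an independent check; the alternating sum of total Betti numbers is
`3 − 6 + 3 = 0` (rank `0` over the regular local ring). [§2.5] -/
theorem vertex_tor_signs (ε : ℤ) (hε : ε ^ 2 = 1) :
    (-ε * (-1) ^ 2 = -ε ∧ -ε * (-1) ^ 3 = ε ∧ -ε * (-1) ^ 4 = -ε ∧ -ε * (-1) ^ 5 = ε) ∧
    (((0 : ℤ) - 3) - (3 - 3) + (3 - 0) = 0) ∧ ((3 : ℤ) - 6 + 3 = 0) ∧ (ε * ε = 1) := by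
  refine ⟨⟨by ring, by ring, by ring, by ring⟩, by norm_num, by norm_num, by nlinarith [hε]⟩

/-- THEOREM 2.7 (report §2.6–2.7): the fibre `V = F̂_{t,0} ⊗ k` of the vertex module. From `0 → θ₋L₁ ⊕ θ₊L₂ → F̂ → N₁ → 0`:
`V = coker(∂) ⊕ N₁ ⊗ k` with `∂ : Tor₁(N₁, k) → E = (θ₋L₁ ⊕ θ₊L₂) ⊗ k = k₊² ⊕ k₋²` equivariant; `μ(L₁′) = μ(N₁) = 3 + ν` (`ν` = number of cubic
generators, `0` off the strata S2/S3) gives `rk ∂₁ = (3 + ν) + 2 − (3 + ν) = 2`; the leading-form computation `in(v′) = −εx` gives `Φ = εI` and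
kills the `θ`-classes of sign `−ε`: `coker ∂ = k₊^{2 − i}` with `i := rk ∂₊ ∈ {0,1,2}`; so `dim V₊ = 2 − i + ν`, `dim V₋ = 3`,
`μ(F̂_{t,0}) = 5 − i + ν ∈ {3, …, 5 + ν}`, and `dim V₋ ≥ 3` always. [§2.7] -/
theorem vertex_fibre (i ν : ℤ) (hi : 0 ≤ i ∧ i ≤ 2) (hν : 0 ≤ ν) :
    ((3 + ν) + 2 - (3 + ν) = 2) ∧ (0 ≤ 2 - i + ν) ∧ ((2 - i + ν) + 3 = 5 - i + ν) ∧ (3 ≤ 5 - i + ν) ∧ (5 - i + ν ≤ 5 + ν) ∧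
    (∀ ε : ℤ, ε ^ 2 = 1 → (1 + ε) * (1 - ε) = 0) := by
  refine ⟨by ring, by omega, by ring, by omega, by omega, ?_⟩
  intro ε hε; nlinarith [hε]

/-- THEOREM 3.3 (report §3): the dimension count of the punctual census. For an ι-hyperplane `H ⊂ V` of sign `s` the balanced colength-2
submodules under `N_H` form the projective space `P(H) = ℙ(U(H)_{−s}^∨)` with `dim U(H)_{−s} = (4 − r(H)) + dim V_{−s}`, `r(H)` = the rank of the
dropped generator's row in the linear syzygy matrix, `0 ≤ r(H) ≤ 4`; and `r(H) ≤ dim LS^{[V_s]} ≤ 1 + dim V_{−s}`: for `s = −` this is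
`dim LS⁺(N₁) − rk ∂₊ ≤ (3 + ν) − i = 1 + (2 − i + ν)`, for `s = +` it is `r ≤ 4 ≤ 1 + 3`. CONSEQUENCE: `dim P(H) = dim V_{−s} + 3 − r(H) ≥ 2`
for EVERY `H` — every balanced ι-stable colength-2 submodule of `F̂_{t,0}` lies on an irreducible family of dimension `≥ 2` at fixed `t`.
[§3.3] -/
theorem census_dimension (a b r i ν : ℤ) (ha : a = 2 - i + ν) (hb : b = 3) (_hi : 0 ≤ i ∧ i ≤ 2) (_hν : 0 ≤ ν)
    (_hr0 : 0 ≤ r) (hr4 : r ≤ 4) :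
    (r ≤ (3 + ν) - i → 2 ≤ a + 3 - r) ∧ (2 ≤ b + 3 - r) ∧ ((3 + ν) - i = 1 + a) ∧ (4 ≤ 1 + b) ∧
    ((4 - r) + a - 1 = a + 3 - r) := by
  refine ⟨?_, ?_, ?_, ?_, ?_⟩ <;> omega

/-- THEOREM 3.2 / 3.4 (report §3): the type bookkeeping behind `census_dimension`. A length-2 ι-quotient `T₀` at the vertex has composition
factors `(k_s, k_{s′})` and index `t_0(T₀) = 16·#{+} − 16·#{−}`; a CURVILINEAR quotient has `s′ = −s` automatically (`ι = −1` on `𝔪/𝔪²`), so is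
balanced (index `16 − 16 = 0`); an `𝔪`-type quotient `V/W` is balanced iff `W` has codimension `1` in each of `V₊`, `V₋`; since `t_0(F̂_t) = 0`
(THEOREM 1.2), H2's `t ≡ 0` forces `t_0(T₀) = 0`, excluding the pure-sign quotients (index `±32`). Family dimensions: `𝔪`-type
`(a − 1) + (b − 1)`; type `B(s)` under `H`: `dim V_{−s} + (4 − r) − 1`; all of these sit inside the `P(H)`'s. [§3.2, §3.4] -/
theorem census_projective_families (a b r : ℤ) :
    ((16 : ℤ) - 16 = 0 ∧ (16 : ℤ) + 16 = 32 ∧ (-16 : ℤ) - 16 = -32 ∧ (32 : ℤ) ≠ 0) ∧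
    ((a - 1) + (b - 1) = a + b - 2) ∧ (b + (4 - r) - 1 = b + 3 - r) ∧ (a + (4 - r) - 1 = a + 3 - r) := by
  refine ⟨by norm_num, by ring, by ring, by ring⟩

/-- §2.8 / §6 (report): the special strata of `T = {z₃ ∉ {z₁,z₂}}` and their codimensions. The configuration space of (a line, three points) in
`ℙ³` has dimension `4 + 9 = 13` with ONE open `PGL₄`-orbit; its complement inside `T ∖ R` consists of S1 `z₁ = z₂` (codim `1` in `C³`: dim `2`),
S3 `z_i, z_j` in a common `g`-fibre (chord meets `ℓ_p`; dim `2`, three components), S2 `z₁ + z₂ + z₃ ∈ |h|` (dim `1`), and `z_i ∈ h_p` (dim `2`,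
REMOVABLE: `p` is a torsor choice); the record stratum R `z₁ + z₂ + z₃ ∈ |g|` (dim `1`) is where `h⁰(M₀) = 1`. The regularity of `I_{Γ₆}` is
`(index) + 1 = 2 + 1 = 3` on all of `T ∖ R` (`h_{Γ₆}(2) = 10 − 4 = 6 = deg Γ₆`), so first syzygies have internal degree `≤ 4` and generators degree
`≤ 3` everywhere off R; the numbers of cubic generators are `ν = 0` (generic, S1, S4), `ν = 1` (S2, S3). [§2.8] -/
theorem special_strata_count :
    ((4 : ℤ) + 9 = 13 ∧ (15 : ℤ) - 13 = 2) ∧ ((3 : ℤ) - 1 = 2 ∧ (3 : ℤ) - 2 = 1) ∧ ((10 : ℤ) - 4 = 6 ∧ (2 : ℤ) + 1 = 3 ∧ (3 : ℤ) + 1 = 4) ∧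
    ((12 : ℤ) - 9 = 3 ∧ (12 : ℤ) - (9 - 1) = 3 + 1) := by
  norm_num

/-- THEOREM 4.1 (report §4): the vertex module ON THE RECORD CURVE `R` (`z₁ + z₂ + z₃ ∈ |g|`, `M₀ ≅ 𝒪_C`): `gr_Δ N₁ = ⊕_{k≥0} H⁰(kK) = A` is free
cyclic (generator = the plane `H₀ ⊃ ℓ_p ∪ ℓ′` through all six points, `h⁰(K − Γ₆) = 1`), so `N₁,0 ≅ 𝒪_{S,0}` with Koszul Tor's `(1; 1,1; 1)` of signs
`(+; +,−; −)` and index `1 − (1 − 1) + (−1) = 0` (= THEOREM 1.2 on R); `rk ∂₁ = 1` (the syzygy `θ₋n₀ = 0` maps to the generator `ū`, `θ₊n₀ = 0`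
to `0`), so `μ(L₁′) = 1 + 2 − 1 = 2`, `coker ∂ = k₊ ⊕ k₋`, `μ(F̂_{t₀,0}) = 1 + 2 = 3`, `V = k₊² ⊕ k₋`; the junk there has length `ℓ′ = 4`, balanced
`2 + 2` (`len R¹α_*𝓛₀ = 4 + 1 = 5`, `ℓ′ = 5 − 1 = 4`); colength of the arc-limits `N₁^{lim} ⊂ N₁(t₀)`: `(1 − 0) + (4 − 3) = 2`. [§4.1] -/
theorem record_vertex_module :
    ((1 : ℤ) - (1 - 1) + (-1) = 0) ∧ ((1 : ℤ) + 2 - 1 = 2) ∧ ((1 : ℤ) + 2 = 3) ∧ ((2 : ℤ) + 1 = 3) ∧ ((2 : ℤ) + 2 = 4) ∧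
    ((1 - 0 : ℤ) + (4 - 3) = 2) ∧ ((4 : ℤ) + 1 = 5 ∧ (5 : ℤ) - 1 = 4) := by
  norm_num

/-- PROPOSITION 5.1 (report §5): the `j = 2` sub-row at `b = n` (pinching curve `Z₁ = z₁ − C`, curve junk of θ-degree `8`): on `C × C`,
`𝓛₀′ = Λ₁(−{z₁}×C) ≡ 4f₁ + 4f₂ + Δ` has `(𝓛₀′)² = 2·16 + 8 + 8 − 6 = 42`, `𝓛₀′·K = 24 + 24 + 12 = 60`, `χ = 9 + (42 − 60)/2 = 0`,
`𝓛₀′|_Δ = g − z₁` (degree `2`, `h⁰ = 1`, `h¹ = 1 − (2 + 1 − 4) = 2`), `len R¹α_* = 2`, so `χ(N₁) = 0 + 2 = 2` and the deficit is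
`ℓ′ = χ(N₁) + 2 = 4 = χ(T₁Q)` with `θ·[T₁Q] = 4j = 8`; the junk curve `Y = A ∪ ιA` ranges over `±C`-translates inside `Θ_{±n}` (two 2-dimensional
families `C + C₂ − h`, `g − C₂ − C`), so by (KR) only rigid positions of `A` relative to `F̂` can carry an object (NOT enumerated). [§5.1] -/
theorem j2_deficit :
    ((2 * 16 + 8 + 8 - 6 : ℤ) = 42) ∧ ((24 + 24 + 12 : ℤ) = 60) ∧ ((9 : ℤ) + (42 - 60) / 2 = 0) ∧
    ((1 : ℤ) - (2 + 1 - 4) = 2) ∧ ((0 : ℤ) + 2 = 2) ∧ ((2 : ℤ) + 2 = 4) ∧ ((4 : ℤ) * 2 = 8) ∧ ((5 - 1 : ℤ) = 4 ∧ (4 - 0 : ℤ) = 4) := by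
  norm_num

end H2W2CornerEight

/-!
## Appendix (report §8, ADDENDUM A): tool (T1) at `b ∈ Θ + x` — the pinched module is locally free at the fixed node and `t_x(F̂) = 0`

For `x ∈ J[2]` and `b ∈ Θ + x` generic, `S_b` has a single node `x` (A₁; exceptional curve `E ≅ ℙ¹`, `E² = −2`, fixed POINTWISE by the lifted involution,
which acts by `−1` on `N_E`; no other fixed points since `D_b ∩ J[2] = {x}`). For an `ι̃`-linearised line bundle of `E`-degree `d` the holomorphic Lefschetz
number is `ε(d/2 + 1/2 − 2/4) = εd/2`, an integer only for `d` even: so the full sheaf `Ñ₁` of the pinched module has EVEN `E`-degree, `N₁` is locally free at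
`x` (local class `0 ∈ Cl(A₁) = ℤ/2`: [VII] 7.3's `ε_x = 0` is forced), and `t_x(F̂) = 16·εd/2 = 0`: the junk at `x` is balanced of even length,
`ℓ′ = λ²/2 − 8 − 4j ∈ {0, 2, 4}`. No accepted declaration is modified.
-/

section H2W2CornerEightAppendix

/-- THEOREM 8.3 (report §8): the `(−2)`-curve contribution `ε(d/2 + (1 − 0)/2 + (−2)/4) = εd/2` vanishes for `d = 0` and is a half-integer for `d = 1`;
since the Lefschetz number is an integer and `E` is the ONLY fixed component, `d` is even, i.e. `d = 0` in `{0, 1}`, and `t_x(F̂) = 16·(d/2) = 0` (for `d = 1`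
it would be `8 ∉ 16ℤ`, incompatible with any finite junk: `t(k_±) = ±16`). Model checks: `𝔽₂ →` quadric cone (second fixed curve `C_∞`, `n = +2`):
`L(𝒪) = 0 + (1/2 + 2/4) = 1`, `L(𝒪(f)) = ε_E/2 + 3ε_∞/2 ∈ ℤ` for all signs; `ℙ² / 𝔽₁`: `3/4 + 1/4 = 1`, `E` with `n = −1` contributes `1/2 − 1/4 = 1/4`.
[H2-EXISTENCE-SIDE-8 §8] -/
theorem theta_translate_node_index :
    ((1 : ℚ) / 2 + (-2) / 4 = 0) ∧ (∀ d : ℤ, (d = 0 ∨ d = 1) → (2 ∣ d) → d = 0) ∧ (¬ (2 : ℤ) ∣ 1) ∧ ((16 : ℤ) * 0 = 0 ∧ ¬ (16 : ℤ) ∣ 8) ∧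
    ((0 : ℚ) + (1 / 2 + 2 / 4) = 1) ∧ (∀ e f : ℤ, (e = 1 ∨ e = -1) → (f = 1 ∨ f = -1) → (2 : ℤ) ∣ (e + 3 * f)) ∧
    ((3 : ℚ) / 4 + 1 / 4 = 1 ∧ (1 : ℚ) / 2 + (-1) / 4 = 1 / 4) := by
  refine ⟨by norm_num, ?_, by decide, ⟨by norm_num, by decide⟩, by norm_num, ?_, by norm_num⟩
  · intro d hd h2; rcases hd with rfl | rfl
    · rfl
    · exact absurd h2 (by decide)
  · intro e f he hf
    rcases he with rfl | rfl <;> rcases hf with rfl | rfl <;> decide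

end H2W2CornerEightAppendix

end Summit.HodgeConjecture.HodgeConjecture.WeilTypeLadder
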